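import Summits.CriticalPhenomena.PercolationContinuityZ3.Theorems.PercNearOneGluingNoHeavyLowerTailSunflowerLawJoinCertificate
import HarnessLib

/-!
# `NoHeavyLowerTail` (crux stmt-CriticalPhenomena-4575), abstract sunflower cubic: (C1) `max(a,b)·(ab − e₂) ≥ e₃` ON THE SIX-PETAL
# GRADED `K₄` STRUCTURE — the last open class of the four-point census — by the cubic sign law and three sheet identities

Support file (seat `prim-ineq-gen-2` gen 32; `--supports stmt-CriticalPhenomena-4575`).  Nothing is asserted about the crux; no `sorry`, no named
facts, no definitions, standard axioms.  Memo: run/shared/lean/prim/prim-ineq-gen-2/CUBIC-SIGN-LAW-GEN32.md §2–§3.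

THE STRUCTURE.  Four coins `x₁,x₂,x₃,x₄` with biases `p₁,p₂,p₃,t` (`q_i = 1 − p_i`); label a configuration `S ⊆ {1,2,3,4}` by `B` if `|S| ≤ 1`,
by the PETAL `S` if `|S| = 2` (six petals, the edges of `K₄`), by `A` if `|S| ≥ 3`.  Cells: `b = P(|S| ≤ 1)`, `a = P(|S| ≥ 3)`,
`m_{ij} = P(S = {i,j})`.  Every 3-colouring of the edges of `K₄` (the five non-BK, non-pencil bi-saturated classes on four points, gen-31 memo
BK-STRATUM-GEN31 §4) is a MERGING of the six petals into three, and merging only decreases `e₂`, `e₃` of the petal masses; so (C1) for all of them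
follows from the SIX-PETAL inequality proved here (`sixPetal_C1`):  **`e₃(m) ≤ max(a,b)·(ab − e₂(m))` for all `(p₁,p₂,p₃,t) ∈ [0,1]⁴`.**
Throughout, the cells, `q_i`, `π_k = P(|S ∩ {1,2,3}| = k)` and the coefficient polynomials are bound by HYPOTHESES `h… : x = …` (no definitions).

PROOF (the pencil in `t`: at `t = 0` the structure is `PC*(x₁,x₂,x₃)`, at `t = 1` it is `PC(x₁,x₂,x₃)`).  `LA := a(ab − e₂) − e₃ = t·Λ(t)`,
`Λ = L₁ + L₂t + L₃t²` (`sixPetal_LA_eq`), and with `w = b(0) − a(0) = π₀ + π₁ − π₃`, `S₁ = π₁ + π₂`, `u = a(1) − b(1) = S₁ − w`: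
 (α) `L₃ = −N₃ ≤ 0` with `N₃` a nonnegative combination of monomials in `p_i, q_i` (`sixPetal_L3_eq`; an instance of the cubic sign law of
     `…SunflowerCubicSignLaw`) — `Λ` is CONCAVE;
 (β) `L₁ = π₃·(π₀(2 − π₀) − w·(π₀ + π₁))` (`sixPetal_L1_eq`) — `Λ(0) ≥ 0` when `a(0) ≥ b(0)`;
 (γ) `S₁²L₁ + S₁L₂w + L₃w² = π₀π₃·(u²(1 + u + w + π₃) + u·w·(2 − π₃))` (`sixPetal_crossing_eq`) — `Λ ≥ 0` at the crossing `t* = w/S₁` (`a = b`);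
 (δ) `L₁ + L₂ + L₃ = u·π₀π₃` (`sixPetal_L_sum_eq`; `AG(PC) = π₀π₃`) — `Λ(1) ≥ 0` when `a(1) ≥ b(1)`;
 (ε) `a − b = −w + t·S₁` (`sixPetal_a_sub_b`), so `{t : a ≥ b}` is an up-interval, on which the concave `Λ` is `≥ 0` by (β)/(γ) and (δ)
     (`sixPetal_LA_nonneg`);
 the B-side is the A-side at `(1−p, 1−t)` (`sixPetal_LB_nonneg`, self-duality `S ↦ Sᶜ`); `sixPetal_C1` combines them.
-/

namespace Summit.CriticalPhenomena.PercolationContinuityZ3.Theorems.SunflowerPartition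

namespace FourPointSixPetal

/-- A concave quadratic that is nonnegative at two points is nonnegative between them. [folklore] -/
theorem quad_concave_between {L₁ L₂ L₃ x y s : ℝ} (hL₃ : L₃ ≤ 0) (hs0 : 0 ≤ s) (hs1 : s ≤ 1)
    (hx : 0 ≤ L₁ + L₂ * x + L₃ * x ^ 2) (hy : 0 ≤ L₁ + L₂ * y + L₃ * y ^ 2) :
    0 ≤ L₁ + L₂ * ((1 - s) * x + s * y) + L₃ * ((1 - s) * x + s * y) ^ 2 := by
  have key : L₁ + L₂ * ((1 - s) * x + s * y) + L₃ * ((1 - s) * x + s * y) ^ 2 =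
      (1 - s) * (L₁ + L₂ * x + L₃ * x ^ 2) + s * (L₁ + L₂ * y + L₃ * y ^ 2) + (-L₃) * (s * (1 - s) * (x - y) ^ 2) := by
    ring
  rw [key]
  have h1 : 0 ≤ (1 - s) * (L₁ + L₂ * x + L₃ * x ^ 2) := mul_nonneg (by linarith) hx
  have h2 : 0 ≤ s * (L₁ + L₂ * y + L₃ * y ^ 2) := mul_nonneg hs0 hy
  have h3 : 0 ≤ (-L₃) * (s * (1 - s) * (x - y) ^ 2) :=
    mul_nonneg (by linarith) (mul_nonneg (mul_nonneg hs0 (by linarith)) (sq_nonneg _))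
  linarith

section SixPetal

variable {p₁ p₂ p₃ t q₁ q₂ q₃ a b m₁₂ m₁₃ m₂₃ m₁₄ m₂₄ m₃₄ π₀ π₁ π₂ π₃ L₁ L₂ L₃ : ℝ}

/-- (ε) `a − b = −w + t·S₁` with `w = π₀ + π₁ − π₃`, `S₁ = π₁ + π₂`. [this work] -/
theorem sixPetal_a_sub_b
    (hq₁ : q₁ = 1 - p₁) (hq₂ : q₂ = 1 - p₂) (hq₃ : q₃ = 1 - p₃)
    (ha : a = p₁ * p₂ * p₃ + t * (p₁ * p₂ * q₃ + p₁ * q₂ * p₃ + q₁ * p₂ * p₃))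
    (hb : b = q₁ * q₂ * q₃ + (1 - t) * (p₁ * q₂ * q₃ + q₁ * p₂ * q₃ + q₁ * q₂ * p₃))
    (hπ₀ : π₀ = q₁ * q₂ * q₃) (hπ₁ : π₁ = p₁ * q₂ * q₃ + q₁ * p₂ * q₃ + q₁ * q₂ * p₃)
    (hπ₂ : π₂ = p₁ * p₂ * q₃ + p₁ * q₂ * p₃ + q₁ * p₂ * p₃) (hπ₃ : π₃ = p₁ * p₂ * p₃) :
    a - b = -(π₀ + π₁ - π₃) + t * (π₁ + π₂) := by
  rw [ha, hb, hπ₀, hπ₁, hπ₂, hπ₃, hq₁, hq₂, hq₃]; ring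

/-- The four cell classes partition: `π₀ + π₁ + π₂ + π₃ = 1`. [this work] -/
theorem sixPetal_pi_sum (hq₁ : q₁ = 1 - p₁) (hq₂ : q₂ = 1 - p₂) (hq₃ : q₃ = 1 - p₃)
    (hπ₀ : π₀ = q₁ * q₂ * q₃) (hπ₁ : π₁ = p₁ * q₂ * q₃ + q₁ * p₂ * q₃ + q₁ * q₂ * p₃)
    (hπ₂ : π₂ = p₁ * p₂ * q₃ + p₁ * q₂ * p₃ + q₁ * p₂ * p₃) (hπ₃ : π₃ = p₁ * p₂ * p₃) :
    π₀ + π₁ + π₂ + π₃ = 1 := by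
  rw [hπ₀, hπ₁, hπ₂, hπ₃, hq₁, hq₂, hq₃]; ring

/-- `LA = a(ab − e₂(m)) − e₃(m) = t·(L₁ + L₂t + L₃t²)` with the explicit coefficient polynomials `L₁, L₂, L₃`. [this work] -/
theorem sixPetal_LA_eq
    (hq₁ : q₁ = 1 - p₁) (hq₂ : q₂ = 1 - p₂) (hq₃ : q₃ = 1 - p₃)
    (ha : a = p₁ * p₂ * p₃ + t * (p₁ * p₂ * q₃ + p₁ * q₂ * p₃ + q₁ * p₂ * p₃))
    (hb : b = q₁ * q₂ * q₃ + (1 - t) * (p₁ * q₂ * q₃ + q₁ * p₂ * q₃ + q₁ * q₂ * p₃))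
    (h₁₂ : m₁₂ = (1 - t) * (p₁ * p₂ * q₃)) (h₁₃ : m₁₃ = (1 - t) * (p₁ * q₂ * p₃)) (h₂₃ : m₂₃ = (1 - t) * (q₁ * p₂ * p₃))
    (h₁₄ : m₁₄ = t * (p₁ * q₂ * q₃)) (h₂₄ : m₂₄ = t * (q₁ * p₂ * q₃)) (h₃₄ : m₃₄ = t * (q₁ * q₂ * p₃))
    (hL₁ : L₁ = -p₁*p₂*p₃^3 - p₁*p₂^3*p₃ - p₁^3*p₂*p₃ + 2*p₁*p₂^2*p₃^3 + 2*p₁*p₂^3*p₃^2 + 2*p₁^2*p₂*p₃^3 + 3*p₁^2*p₂^2*p₃^2 + 2*p₁^2*p₂^3*p₃ + 2*p₁^3*p₂*p₃^2 + 2*p₁^3*p₂^2*p₃ - 2*p₁*p₂^3*p₃^3 - 6*p₁^2*p₂^2*p₃^3 - 6*p₁^2*p₂^3*p₃^2 - 2*p₁^3*p₂*p₃^3 - 6*p₁^3*p₂^2*p₃^2 - 2*p₁^3*p₂^3*p₃ + 5*p₁^2*p₂^3*p₃^3 + 5*p₁^3*p₂^2*p₃^3 + 5*p₁^3*p₂^3*p₃^2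 - 3*p₁^3*p₂^3*p₃^3)
    (hL₂ : L₂ = 2*p₁*p₂*p₃^3 + 3*p₁*p₂^2*p₃^2 + 2*p₁*p₂^3*p₃ + 3*p₁^2*p₂*p₃^2 + 3*p₁^2*p₂^2*p₃ + 2*p₁^3*p₂*p₃ - 6*p₁*p₂^2*p₃^3 - 6*p₁*p₂^3*p₃^2 - 6*p₁^2*p₂*p₃^3 - 18*p₁^2*p₂^2*p₃^2 - 6*p₁^2*p₂^3*p₃ - 6*p₁^3*p₂*p₃^2 - 6*p₁^3*p₂^2*p₃ + 5*p₁*p₂^3*p₃^3 + 18*p₁^2*p₂^2*p₃^3 + 18*p₁^2*p₂^3*p₃^2 + 5*p₁^3*p₂*p₃^3 + 18*p₁^3*p₂^2*p₃^2 + 5*p₁^3*p₂^3*p₃ - 12*p₁^2*p₂^3*p₃^3 - 12*p₁^3*p₂^2*p₃^3 - 12*p₁^3*p₂^3*p₃^2 + 6*p₁^3*p₂^3*p₃^3)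
    (hL₃ : L₃ = -p₁*p₂*p₃ + 2*p₁*p₂*p₃^2 + 2*p₁*p₂^2*p₃ + 2*p₁^2*p₂*p₃ - 2*p₁*p₂*p₃^3 - 6*p₁*p₂^2*p₃^2 - 2*p₁*p₂^3*p₃ - 6*p₁^2*p₂*p₃^2 - 6*p₁^2*p₂^2*p₃ - 2*p₁^3*p₂*p₃ + 5*p₁*p₂^2*p₃^3 + 5*p₁*p₂^3*p₃^2 + 5*p₁^2*p₂*p₃^3 + 18*p₁^2*p₂^2*p₃^2 + 5*p₁^2*p₂^3*p₃ + 5*p₁^3*p₂*p₃^2 + 5*p₁^3*p₂^2*p₃ - 3*p₁*p₂^3*p₃^3 - 12*p₁^2*p₂^2*p₃^3 - 12*p₁^2*p₂^3*p₃^2 - 3*p₁^3*p₂*p₃^3 - 12*p₁^3*p₂^2*p₃^2 - 3*p₁^3*p₂^3*p₃ + 6*p₁^2*p₂^3*p₃^3 + 6*p₁^3*p₂^2*p₃^3 + 6*p₁^3*p₂^3*p₃^2 - 2*p₁^3*p₂^3*p₃^3) :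
    a * (a * b - (m₁₂*m₁₃ + m₁₂*m₂₃ + m₁₂*m₁₄ + m₁₂*m₂₄ + m₁₂*m₃₄ + m₁₃*m₂₃ + m₁₃*m₁₄ + m₁₃*m₂₄ + m₁₃*m₃₄ + m₂₃*m₁₄ + m₂₃*m₂₄ +
        m₂₃*m₃₄ + m₁₄*m₂₄ + m₁₄*m₃₄ + m₂₄*m₃₄)) -
      (m₁₂*m₁₃*m₂₃ + m₁₂*m₁₃*m₁₄ + m₁₂*m₁₃*m₂₄ + m₁₂*m₁₃*m₃₄ + m₁₂*m₂₃*m₁₄ + m₁₂*m₂₃*m₂₄ + m₁₂*m₂₃*m₃₄ + m₁₂*m₁₄*m₂₄ +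
        m₁₂*m₁₄*m₃₄ + m₁₂*m₂₄*m₃₄ + m₁₃*m₂₃*m₁₄ + m₁₃*m₂₃*m₂₄ + m₁₃*m₂₃*m₃₄ + m₁₃*m₁₄*m₂₄ + m₁₃*m₁₄*m₃₄ + m₁₃*m₂₄*m₃₄ +
        m₂₃*m₁₄*m₂₄ + m₂₃*m₁₄*m₃₄ + m₂₃*m₂₄*m₃₄ + m₁₄*m₂₄*m₃₄) =
      t * (L₁ + L₂ * t + L₃ * t ^ 2) := by
  rw [ha, hb, h₁₂, h₁₃, h₂₃, h₁₄, h₂₄, h₃₄, hL₁, hL₂, hL₃, hq₁, hq₂, hq₃]; ring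

/-- (α) The leading coefficient `L₃` is `−N₃`, `N₃` a nonnegative combination of products of `p_i` and `q_i = 1 − p_i` (its tensor-Bernstein
expansion): the cubic sign law on this pencil. [this work] -/
theorem sixPetal_L3_eq (hq₁ : q₁ = 1 - p₁) (hq₂ : q₂ = 1 - p₂) (hq₃ : q₃ = 1 - p₃)
    (hL₃ : L₃ = -p₁*p₂*p₃ + 2*p₁*p₂*p₃^2 + 2*p₁*p₂^2*p₃ + 2*p₁^2*p₂*p₃ - 2*p₁*p₂*p₃^3 - 6*p₁*p₂^2*p₃^2 - 2*p₁*p₂^3*p₃ - 6*p₁^2*p₂*p₃^2 - 6*p₁^2*p₂^2*p₃ - 2*p₁^3*p₂*p₃ + 5*p₁*p₂^2*p₃^3 + 5*p₁*p₂^3*p₃^2 + 5*p₁^2*p₂*p₃^3 + 18*p₁^2*p₂^2*p₃^2 + 5*p₁^2*p₂^3*p₃ + 5*p₁^3*p₂*p₃^2 + 5*p₁^3*p₂^2*p₃ - 3*p₁*p₂^3*p₃^3 - 12*p₁^2*p₂^2*p₃^3 - 12*p₁^2*p₂^3*p₃^2 - 3*p₁^3*p₂*p₃^3 - 12*p₁^3*p₂^2*p₃^2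 - 3*p₁^3*p₂^3*p₃ + 6*p₁^2*p₂^3*p₃^3 + 6*p₁^3*p₂^2*p₃^3 + 6*p₁^3*p₂^3*p₃^2 - 2*p₁^3*p₂^3*p₃^3) :
    L₃ = -(p₁*q₁^2*p₂*q₂^2*p₃*q₃^2 + p₁*q₁^2*p₂*q₂^2*p₃^3 + 2*p₁*q₁^2*p₂^2*q₂*p₃^2*q₃ + p₁*q₁^2*p₂^2*q₂*p₃^3 + p₁*q₁^2*p₂^3*p₃*q₃^2 + p₁*q₁^2*p₂^3*p₃^2*q₃ + 2*p₁^2*q₁*p₂*q₂^2*p₃^2*q₃ + p₁^2*q₁*p₂*q₂^2*p₃^3 + 2*p₁^2*q₁*p₂^2*q₂*p₃*q₃^2 + 2*p₁^2*q₁*p₂^2*q₂*p₃^2*q₃ + p₁^2*q₁*p₂^3*p₃*q₃^2 + p₁^3*p₂*q₂^2*p₃*q₃^2 + p₁^3*p₂*q₂^2*p₃^2*q₃ + p₁^3*p₂^2*q₂*p₃*q₃^2) := by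
  rw [hL₃, hq₁, hq₂, hq₃]; ring

/-- (β) `L₁ = π₃·(π₀·(2 − π₀) − w·(π₀ + π₁))`: the first-order exit rate from the `PC*` sheet. [this work] -/
theorem sixPetal_L1_eq (hq₁ : q₁ = 1 - p₁) (hq₂ : q₂ = 1 - p₂) (hq₃ : q₃ = 1 - p₃)
    (hπ₀ : π₀ = q₁ * q₂ * q₃) (hπ₁ : π₁ = p₁ * q₂ * q₃ + q₁ * p₂ * q₃ + q₁ * q₂ * p₃) (hπ₃ : π₃ = p₁ * p₂ * p₃)
    (hL₁ : L₁ = -p₁*p₂*p₃^3 - p₁*p₂^3*p₃ - p₁^3*p₂*p₃ + 2*p₁*p₂^2*p₃^3 + 2*p₁*p₂^3*p₃^2 + 2*p₁^2*p₂*p₃^3 + 3*p₁^2*p₂^2*p₃^2 + 2*p₁^2*p₂^3*p₃ + 2*p₁^3*p₂*p₃^2 + 2*p₁^3*p₂^2*p₃ - 2*p₁*p₂^3*p₃^3 - 6*p₁^2*p₂^2*p₃^3 - 6*p₁^2*p₂^3*p₃^2 - 2*p₁^3*p₂*p₃^3 - 6*p₁^3*p₂^2*p₃^2 - 2*p₁^3*p₂^3*p₃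 + 5*p₁^2*p₂^3*p₃^3 + 5*p₁^3*p₂^2*p₃^3 + 5*p₁^3*p₂^3*p₃^2 - 3*p₁^3*p₂^3*p₃^3) :
    L₁ = π₃ * (π₀ * (2 - π₀) - (π₀ + π₁ - π₃) * (π₀ + π₁)) := by
  rw [hL₁, hπ₀, hπ₁, hπ₃, hq₁, hq₂, hq₃]; ring

/-- (δ) `Λ(1) = L₁ + L₂ + L₃ = u·π₀·π₃` (`u = a(1) − b(1) = S₁ − w`; `AG` of `PC(x₁,x₂,x₃)` is `π₀π₃`). [this work] -/
theorem sixPetal_L_sum_eq (hq₁ : q₁ = 1 - p₁) (hq₂ : q₂ = 1 - p₂) (hq₃ : q₃ = 1 - p₃)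
    (hπ₀ : π₀ = q₁ * q₂ * q₃) (hπ₁ : π₁ = p₁ * q₂ * q₃ + q₁ * p₂ * q₃ + q₁ * q₂ * p₃)
    (hπ₂ : π₂ = p₁ * p₂ * q₃ + p₁ * q₂ * p₃ + q₁ * p₂ * p₃) (hπ₃ : π₃ = p₁ * p₂ * p₃)
    (hL₁ : L₁ = -p₁*p₂*p₃^3 - p₁*p₂^3*p₃ - p₁^3*p₂*p₃ + 2*p₁*p₂^2*p₃^3 + 2*p₁*p₂^3*p₃^2 + 2*p₁^2*p₂*p₃^3 + 3*p₁^2*p₂^2*p₃^2 + 2*p₁^2*p₂^3*p₃ + 2*p₁^3*p₂*p₃^2 + 2*p₁^3*p₂^2*p₃ - 2*p₁*p₂^3*p₃^3 - 6*p₁^2*p₂^2*p₃^3 - 6*p₁^2*p₂^3*p₃^2 - 2*p₁^3*p₂*p₃^3 - 6*p₁^3*p₂^2*p₃^2 - 2*p₁^3*p₂^3*p₃ + 5*p₁^2*p₂^3*p₃^3 + 5*p₁^3*p₂^2*p₃^3 + 5*p₁^3*p₂^3*p₃^2 - 3*p₁^3*p₂^3*p₃^3)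
    (hL₂ : L₂ = 2*p₁*p₂*p₃^3 + 3*p₁*p₂^2*p₃^2 + 2*p₁*p₂^3*p₃ + 3*p₁^2*p₂*p₃^2 + 3*p₁^2*p₂^2*p₃ + 2*p₁^3*p₂*p₃ - 6*p₁*p₂^2*p₃^3 - 6*p₁*p₂^3*p₃^2 - 6*p₁^2*p₂*p₃^3 - 18*p₁^2*p₂^2*p₃^2 - 6*p₁^2*p₂^3*p₃ - 6*p₁^3*p₂*p₃^2 - 6*p₁^3*p₂^2*p₃ + 5*p₁*p₂^3*p₃^3 + 18*p₁^2*p₂^2*p₃^3 + 18*p₁^2*p₂^3*p₃^2 + 5*p₁^3*p₂*p₃^3 + 18*p₁^3*p₂^2*p₃^2 + 5*p₁^3*p₂^3*p₃ - 12*p₁^2*p₂^3*p₃^3 - 12*p₁^3*p₂^2*p₃^3 - 12*p₁^3*p₂^3*p₃^2 + 6*p₁^3*p₂^3*p₃^3)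
    (hL₃ : L₃ = -p₁*p₂*p₃ + 2*p₁*p₂*p₃^2 + 2*p₁*p₂^2*p₃ + 2*p₁^2*p₂*p₃ - 2*p₁*p₂*p₃^3 - 6*p₁*p₂^2*p₃^2 - 2*p₁*p₂^3*p₃ - 6*p₁^2*p₂*p₃^2 - 6*p₁^2*p₂^2*p₃ - 2*p₁^3*p₂*p₃ + 5*p₁*p₂^2*p₃^3 + 5*p₁*p₂^3*p₃^2 + 5*p₁^2*p₂*p₃^3 + 18*p₁^2*p₂^2*p₃^2 + 5*p₁^2*p₂^3*p₃ + 5*p₁^3*p₂*p₃^2 + 5*p₁^3*p₂^2*p₃ - 3*p₁*p₂^3*p₃^3 - 12*p₁^2*p₂^2*p₃^3 - 12*p₁^2*p₂^3*p₃^2 - 3*p₁^3*p₂*p₃^3 - 12*p₁^3*p₂^2*p₃^2 - 3*p₁^3*p₂^3*p₃ + 6*p₁^2*p₂^3*p₃^3 + 6*p₁^3*p₂^2*p₃^3 + 6*p₁^3*p₂^3*p₃^2 - 2*p₁^3*p₂^3*p₃^3) :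
    L₁ + L₂ + L₃ = ((π₁ + π₂) - (π₀ + π₁ - π₃)) * π₀ * π₃ := by
  rw [hL₁, hL₂, hL₃, hπ₀, hπ₁, hπ₂, hπ₃, hq₁, hq₂, hq₃]; ring

set_option maxHeartbeats 400000 in
/-- (γ) THE CROSSING IDENTITY: with `w = π₀ + π₁ − π₃`, `S₁ = π₁ + π₂`, `u = S₁ − w`,
`S₁²·L₁ + S₁·L₂·w + L₃·w² = π₀π₃·(u²(1 + u + w + π₃) + u·w·(2 − π₃))` — `Λ ≥ 0` at `t* = w/S₁` where `a = b`. [this work] -/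
theorem sixPetal_crossing_eq (hq₁ : q₁ = 1 - p₁) (hq₂ : q₂ = 1 - p₂) (hq₃ : q₃ = 1 - p₃)
    (hπ₀ : π₀ = q₁ * q₂ * q₃) (hπ₁ : π₁ = p₁ * q₂ * q₃ + q₁ * p₂ * q₃ + q₁ * q₂ * p₃)
    (hπ₂ : π₂ = p₁ * p₂ * q₃ + p₁ * q₂ * p₃ + q₁ * p₂ * p₃) (hπ₃ : π₃ = p₁ * p₂ * p₃)
    (hL₁ : L₁ = -p₁*p₂*p₃^3 - p₁*p₂^3*p₃ - p₁^3*p₂*p₃ + 2*p₁*p₂^2*p₃^3 + 2*p₁*p₂^3*p₃^2 + 2*p₁^2*p₂*p₃^3 + 3*p₁^2*p₂^2*p₃^2 + 2*p₁^2*p₂^3*p₃ + 2*p₁^3*p₂*p₃^2 + 2*p₁^3*p₂^2*p₃ - 2*p₁*p₂^3*p₃^3 - 6*p₁^2*p₂^2*p₃^3 - 6*p₁^2*p₂^3*p₃^2 - 2*p₁^3*p₂*p₃^3 - 6*p₁^3*p₂^2*p₃^2 - 2*p₁^3*p₂^3*p₃ + 5*p₁^2*p₂^3*p₃^3 + 5*p₁^3*p₂^2*p₃^3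 + 5*p₁^3*p₂^3*p₃^2 - 3*p₁^3*p₂^3*p₃^3)
    (hL₂ : L₂ = 2*p₁*p₂*p₃^3 + 3*p₁*p₂^2*p₃^2 + 2*p₁*p₂^3*p₃ + 3*p₁^2*p₂*p₃^2 + 3*p₁^2*p₂^2*p₃ + 2*p₁^3*p₂*p₃ - 6*p₁*p₂^2*p₃^3 - 6*p₁*p₂^3*p₃^2 - 6*p₁^2*p₂*p₃^3 - 18*p₁^2*p₂^2*p₃^2 - 6*p₁^2*p₂^3*p₃ - 6*p₁^3*p₂*p₃^2 - 6*p₁^3*p₂^2*p₃ + 5*p₁*p₂^3*p₃^3 + 18*p₁^2*p₂^2*p₃^3 + 18*p₁^2*p₂^3*p₃^2 + 5*p₁^3*p₂*p₃^3 + 18*p₁^3*p₂^2*p₃^2 + 5*p₁^3*p₂^3*p₃ - 12*p₁^2*p₂^3*p₃^3 - 12*p₁^3*p₂^2*p₃^3 - 12*p₁^3*p₂^3*p₃^2 + 6*p₁^3*p₂^3*p₃^3)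
    (hL₃ : L₃ = -p₁*p₂*p₃ + 2*p₁*p₂*p₃^2 + 2*p₁*p₂^2*p₃ + 2*p₁^2*p₂*p₃ - 2*p₁*p₂*p₃^3 - 6*p₁*p₂^2*p₃^2 - 2*p₁*p₂^3*p₃ - 6*p₁^2*p₂*p₃^2 - 6*p₁^2*p₂^2*p₃ - 2*p₁^3*p₂*p₃ + 5*p₁*p₂^2*p₃^3 + 5*p₁*p₂^3*p₃^2 + 5*p₁^2*p₂*p₃^3 + 18*p₁^2*p₂^2*p₃^2 + 5*p₁^2*p₂^3*p₃ + 5*p₁^3*p₂*p₃^2 + 5*p₁^3*p₂^2*p₃ - 3*p₁*p₂^3*p₃^3 - 12*p₁^2*p₂^2*p₃^3 - 12*p₁^2*p₂^3*p₃^2 - 3*p₁^3*p₂*p₃^3 - 12*p₁^3*p₂^2*p₃^2 - 3*p₁^3*p₂^3*p₃ + 6*p₁^2*p₂^3*p₃^3 + 6*p₁^3*p₂^2*p₃^3 + 6*p₁^3*p₂^3*p₃^2 - 2*p₁^3*p₂^3*p₃^3) :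
    (π₁ + π₂) ^ 2 * L₁ + (π₁ + π₂) * L₂ * (π₀ + π₁ - π₃) + L₃ * (π₀ + π₁ - π₃) ^ 2 =
      π₀ * π₃ * (((π₁ + π₂) - (π₀ + π₁ - π₃)) ^ 2 * (1 + ((π₁ + π₂) - (π₀ + π₁ - π₃)) + (π₀ + π₁ - π₃) + π₃) +
        ((π₁ + π₂) - (π₀ + π₁ - π₃)) * (π₀ + π₁ - π₃) * (2 - π₃)) := by
  rw [hL₁, hL₂, hL₃, hπ₀, hπ₁, hπ₂, hπ₃, hq₁, hq₂, hq₃]; ring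

/-- **(C1), A-side, on the six-petal graded `K₄` structure**: if `a ≥ b` then `a·(ab − e₂(m)) ≥ e₃(m)`, for all biases in `[0,1]`. [this work] -/
theorem sixPetal_LA_nonneg (hp₁ : 0 ≤ p₁) (hp₁' : p₁ ≤ 1) (hp₂ : 0 ≤ p₂) (hp₂' : p₂ ≤ 1) (hp₃ : 0 ≤ p₃) (hp₃' : p₃ ≤ 1)
    (ht : 0 ≤ t) (ht' : t ≤ 1)
    (hq₁ : q₁ = 1 - p₁) (hq₂ : q₂ = 1 - p₂) (hq₃ : q₃ = 1 - p₃)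
    (ha : a = p₁ * p₂ * p₃ + t * (p₁ * p₂ * q₃ + p₁ * q₂ * p₃ + q₁ * p₂ * p₃))
    (hb : b = q₁ * q₂ * q₃ + (1 - t) * (p₁ * q₂ * q₃ + q₁ * p₂ * q₃ + q₁ * q₂ * p₃))
    (h₁₂ : m₁₂ = (1 - t) * (p₁ * p₂ * q₃)) (h₁₃ : m₁₃ = (1 - t) * (p₁ * q₂ * p₃)) (h₂₃ : m₂₃ = (1 - t) * (q₁ * p₂ * p₃))
    (h₁₄ : m₁₄ = t * (p₁ * q₂ * q₃)) (h₂₄ : m₂₄ = t * (q₁ * p₂ * q₃)) (h₃₄ : m₃₄ = t * (q₁ * q₂ * p₃))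
    (hab : b ≤ a) :
    m₁₂*m₁₃*m₂₃ + m₁₂*m₁₃*m₁₄ + m₁₂*m₁₃*m₂₄ + m₁₂*m₁₃*m₃₄ + m₁₂*m₂₃*m₁₄ + m₁₂*m₂₃*m₂₄ + m₁₂*m₂₃*m₃₄ + m₁₂*m₁₄*m₂₄ +
        m₁₂*m₁₄*m₃₄ + m₁₂*m₂₄*m₃₄ + m₁₃*m₂₃*m₁₄ + m₁₃*m₂₃*m₂₄ + m₁₃*m₂₃*m₃₄ + m₁₃*m₁₄*m₂₄ + m₁₃*m₁₄*m₃₄ + m₁₃*m₂₄*m₃₄ +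
        m₂₃*m₁₄*m₂₄ + m₂₃*m₁₄*m₃₄ + m₂₃*m₂₄*m₃₄ + m₁₄*m₂₄*m₃₄ ≤
      a * (a * b - (m₁₂*m₁₃ + m₁₂*m₂₃ + m₁₂*m₁₄ + m₁₂*m₂₄ + m₁₂*m₃₄ + m₁₃*m₂₃ + m₁₃*m₁₄ + m₁₃*m₂₄ + m₁₃*m₃₄ + m₂₃*m₁₄ + m₂₃*m₂₄ +
        m₂₃*m₃₄ + m₁₄*m₂₄ + m₁₄*m₃₄ + m₂₄*m₃₄)) := by
  -- the auxiliary quantities, bound by equations (no definitions)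
  obtain ⟨π₀, hπ₀⟩ : ∃ x : ℝ, x = q₁ * q₂ * q₃ := ⟨_, rfl⟩
  obtain ⟨π₁, hπ₁⟩ : ∃ x : ℝ, x = p₁ * q₂ * q₃ + q₁ * p₂ * q₃ + q₁ * q₂ * p₃ := ⟨_, rfl⟩
  obtain ⟨π₂, hπ₂⟩ : ∃ x : ℝ, x = p₁ * p₂ * q₃ + p₁ * q₂ * p₃ + q₁ * p₂ * p₃ := ⟨_, rfl⟩
  obtain ⟨π₃, hπ₃⟩ : ∃ x : ℝ, x = p₁ * p₂ * p₃ := ⟨_, rfl⟩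
  obtain ⟨L₁, hL₁⟩ : ∃ x : ℝ, x = -p₁*p₂*p₃^3 - p₁*p₂^3*p₃ - p₁^3*p₂*p₃ + 2*p₁*p₂^2*p₃^3 + 2*p₁*p₂^3*p₃^2 + 2*p₁^2*p₂*p₃^3 + 3*p₁^2*p₂^2*p₃^2 + 2*p₁^2*p₂^3*p₃ + 2*p₁^3*p₂*p₃^2 + 2*p₁^3*p₂^2*p₃ - 2*p₁*p₂^3*p₃^3 - 6*p₁^2*p₂^2*p₃^3 - 6*p₁^2*p₂^3*p₃^2 - 2*p₁^3*p₂*p₃^3 - 6*p₁^3*p₂^2*p₃^2 - 2*p₁^3*p₂^3*p₃ + 5*p₁^2*p₂^3*p₃^3 + 5*p₁^3*p₂^2*p₃^3 + 5*p₁^3*p₂^3*p₃^2 - 3*p₁^3*p₂^3*p₃^3 := ⟨_, rfl⟩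
  obtain ⟨L₂, hL₂⟩ : ∃ x : ℝ, x = 2*p₁*p₂*p₃^3 + 3*p₁*p₂^2*p₃^2 + 2*p₁*p₂^3*p₃ + 3*p₁^2*p₂*p₃^2 + 3*p₁^2*p₂^2*p₃ + 2*p₁^3*p₂*p₃ - 6*p₁*p₂^2*p₃^3 - 6*p₁*p₂^3*p₃^2 - 6*p₁^2*p₂*p₃^3 - 18*p₁^2*p₂^2*p₃^2 - 6*p₁^2*p₂^3*p₃ - 6*p₁^3*p₂*p₃^2 - 6*p₁^3*p₂^2*p₃ + 5*p₁*p₂^3*p₃^3 + 18*p₁^2*p₂^2*p₃^3 + 18*p₁^2*p₂^3*p₃^2 + 5*p₁^3*p₂*p₃^3 + 18*p₁^3*p₂^2*p₃^2 + 5*p₁^3*p₂^3*p₃ - 12*p₁^2*p₂^3*p₃^3 - 12*p₁^3*p₂^2*p₃^3 - 12*p₁^3*p₂^3*p₃^2 + 6*p₁^3*p₂^3*p₃^3 := ⟨_, rfl⟩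
  obtain ⟨L₃, hL₃⟩ : ∃ x : ℝ, x = -p₁*p₂*p₃ + 2*p₁*p₂*p₃^2 + 2*p₁*p₂^2*p₃ + 2*p₁^2*p₂*p₃ - 2*p₁*p₂*p₃^3 - 6*p₁*p₂^2*p₃^2 - 2*p₁*p₂^3*p₃ - 6*p₁^2*p₂*p₃^2 - 6*p₁^2*p₂^2*p₃ - 2*p₁^3*p₂*p₃ + 5*p₁*p₂^2*p₃^3 + 5*p₁*p₂^3*p₃^2 + 5*p₁^2*p₂*p₃^3 + 18*p₁^2*p₂^2*p₃^2 + 5*p₁^2*p₂^3*p₃ + 5*p₁^3*p₂*p₃^2 + 5*p₁^3*p₂^2*p₃ - 3*p₁*p₂^3*p₃^3 - 12*p₁^2*p₂^2*p₃^3 - 12*p₁^2*p₂^3*p₃^2 - 3*p₁^3*p₂*p₃^3 - 12*p₁^3*p₂^2*p₃^2 - 3*p₁^3*p₂^3*p₃ + 6*p₁^2*p₂^3*p₃^3 + 6*p₁^3*p₂^2*p₃^3 + 6*p₁^3*p₂^3*p₃^2 - 2*p₁^3*p₂^3*p₃^3 := ⟨_, rfl⟩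
  -- the five polynomial identities, instantiated; then the big equations are discarded
  have hsum : π₀ + π₁ + π₂ + π₃ = 1 := sixPetal_pi_sum hq₁ hq₂ hq₃ hπ₀ hπ₁ hπ₂ hπ₃
  have hF1 : a - b = -(π₀ + π₁ - π₃) + t * (π₁ + π₂) :=
    sixPetal_a_sub_b hq₁ hq₂ hq₃ ha hb hπ₀ hπ₁ hπ₂ hπ₃
  have hF2 := sixPetal_LA_eq hq₁ hq₂ hq₃ ha hb h₁₂ h₁₃ h₂₃ h₁₄ h₂₄ h₃₄ hL₁ hL₂ hL₃
  have hF3 := sixPetal_L3_eq hq₁ hq₂ hq₃ hL₃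
  have hF4 := sixPetal_L1_eq hq₁ hq₂ hq₃ hπ₀ hπ₁ hπ₃ hL₁
  have hF5 := sixPetal_crossing_eq hq₁ hq₂ hq₃ hπ₀ hπ₁ hπ₂ hπ₃ hL₁ hL₂ hL₃
  have hF6 := sixPetal_L_sum_eq hq₁ hq₂ hq₃ hπ₀ hπ₁ hπ₂ hπ₃ hL₁ hL₂ hL₃
  rw [← sub_nonneg, hF2]
  clear hF2 hL₁ hL₂ hL₃ ha hb h₁₂ h₁₃ h₂₃ h₁₄ h₂₄ h₃₄
  have hq₁0 : 0 ≤ q₁ := by rw [hq₁]; linarith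
  have hq₂0 : 0 ≤ q₂ := by rw [hq₂]; linarith
  have hq₃0 : 0 ≤ q₃ := by rw [hq₃]; linarith
  -- (α): the leading coefficient is nonpositive
  have hL₃0 : L₃ ≤ 0 := by
    rw [hF3, neg_nonpos]; positivity
  clear hF3
  have hπ₀0 : 0 ≤ π₀ := by rw [hπ₀]; positivity
  have hπ₁0 : 0 ≤ π₁ := by rw [hπ₁]; positivity
  have hπ₂0 : 0 ≤ π₂ := by rw [hπ₂]; positivity
  have hπ₃0 : 0 ≤ π₃ := by rw [hπ₃]; positivity
  clear hπ₀ hπ₁ hπ₂ hπ₃ hq₁ hq₂ hq₃ hq₁0 hq₂0 hq₃0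
  have hπ₀1 : π₀ ≤ 1 := by linarith
  have hπ₃1 : π₃ ≤ 1 := by linarith
  -- (ε): `a ≥ b` means `t·S₁ ≥ w`
  set w := π₀ + π₁ - π₃ with hw
  set S₁ := π₁ + π₂ with hS₁
  have hS₁0 : 0 ≤ S₁ := by rw [hS₁]; linarith
  have htS : w ≤ t * S₁ := by linarith
  have hu0 : 0 ≤ S₁ - w := by
    have h1 : 0 ≤ (1 - t) * S₁ := mul_nonneg (by linarith) hS₁0
    have h2 : (1 - t) * S₁ = S₁ - t * S₁ := by ring
    rw [h2] at h1; linarith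
  clear hF1 hab
  -- (δ): `Λ(1) = u·π₀·π₃ ≥ 0`
  have hΛ1 : 0 ≤ L₁ + L₂ * 1 + L₃ * 1 ^ 2 := by
    have e : L₁ + L₂ * 1 + L₃ * 1 ^ 2 = (S₁ - w) * π₀ * π₃ := by rw [hS₁, hw]; linarith
    rw [e]; exact mul_nonneg (mul_nonneg hu0 hπ₀0) hπ₃0
  clear hF6
  -- it suffices that `Λ(t) ≥ 0`
  suffices hΛ : 0 ≤ L₁ + L₂ * t + L₃ * t ^ 2 from mul_nonneg ht hΛ
  by_cases hw0 : w ≤ 0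
  · -- (β): `a(0) ≥ b(0)`; interpolate between `0` and `1`
    have hΛ0 : 0 ≤ L₁ + L₂ * 0 + L₃ * 0 ^ 2 := by
      have e : L₁ + L₂ * 0 + L₃ * 0 ^ 2 = π₃ * (π₀ * (2 - π₀) - w * (π₀ + π₁)) := by rw [hw]; linarith
      rw [e]
      have h1 : 0 ≤ π₀ * (2 - π₀) := mul_nonneg hπ₀0 (by linarith)
      have h2 : 0 ≤ -w * (π₀ + π₁) := mul_nonneg (by linarith) (by linarith)
      exact mul_nonneg hπ₃0 (by linarith)
    have h := quad_concave_between (x := 0) (y := 1) (s := t) hL₃0 ht ht' hΛ0 hΛ1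
    simpa using h
  · -- (γ): `a(0) < b(0)`; the crossing `t* = w/S₁ ∈ (0, t]`; interpolate between `t*` and `1`
    push Not at hw0
    have hS₁pos : 0 < S₁ := by
      rcases lt_or_eq_of_le hS₁0 with h | h
      · exact h
      · exfalso; rw [← h, mul_zero] at htS; linarith
    obtain ⟨ts, hts⟩ : ∃ x : ℝ, x = w / S₁ := ⟨_, rfl⟩
    have hts0 : 0 ≤ ts := by rw [hts]; exact div_nonneg hw0.le hS₁0
    have htst : ts ≤ t := by rw [hts, div_le_iff₀ hS₁pos]; linarith
    have hts1 : ts ≤ 1 := htst.trans ht'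
    have hΛts : 0 ≤ L₁ + L₂ * ts + L₃ * ts ^ 2 := by
      have e : L₁ + L₂ * ts + L₃ * ts ^ 2 = (S₁ ^ 2 * L₁ + S₁ * L₂ * w + L₃ * w ^ 2) / S₁ ^ 2 := by
        rw [hts]; field_simp
      have hc : S₁ ^ 2 * L₁ + S₁ * L₂ * w + L₃ * w ^ 2 =
          π₀ * π₃ * ((S₁ - w) ^ 2 * (1 + (S₁ - w) + w + π₃) + (S₁ - w) * w * (2 - π₃)) := by
        rw [hS₁, hw]; linarith
      rw [e, hc]
      apply div_nonneg _ (sq_nonneg _)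
      have h1 : 0 ≤ (S₁ - w) ^ 2 * (1 + (S₁ - w) + w + π₃) := mul_nonneg (sq_nonneg _) (by linarith)
      have h2 : 0 ≤ (S₁ - w) * w * (2 - π₃) := mul_nonneg (mul_nonneg hu0 hw0.le) (by linarith)
      exact mul_nonneg (mul_nonneg hπ₀0 hπ₃0) (by linarith)
    rcases lt_or_eq_of_le hts1 with hlt | heq
    · obtain ⟨s, hs⟩ : ∃ x : ℝ, x = (t - ts) / (1 - ts) := ⟨_, rfl⟩
      have hs0 : 0 ≤ s := by rw [hs]; exact div_nonneg (by linarith) (by linarith)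
      have hs1 : s ≤ 1 := by rw [hs, div_le_iff₀ (by linarith)]; linarith
      have hconv : (1 - s) * ts + s * 1 = t := by
        rw [hs]; field_simp; ring
      have h := quad_concave_between (x := ts) (y := 1) (s := s) hL₃0 hs0 hs1 hΛts hΛ1
      rw [hconv] at h
      exact h
    · have : t = 1 := le_antisymm ht' (heq ▸ htst)
      rw [this]; exact hΛ1

/-- **(C1), B-side, on the six-petal graded `K₄` structure**: if `a ≤ b` then `b·(ab − e₂(m)) ≥ e₃(m)` — the A-side for the complementary
structure at `(1 − p, 1 − t)` (self-duality `S ↦ Sᶜ`: its core is our bottom, its petal `{i,j}` our petal `{k,l}`). [this work] -/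
theorem sixPetal_LB_nonneg (hp₁ : 0 ≤ p₁) (hp₁' : p₁ ≤ 1) (hp₂ : 0 ≤ p₂) (hp₂' : p₂ ≤ 1) (hp₃ : 0 ≤ p₃) (hp₃' : p₃ ≤ 1)
    (ht : 0 ≤ t) (ht' : t ≤ 1)
    (hq₁ : q₁ = 1 - p₁) (hq₂ : q₂ = 1 - p₂) (hq₃ : q₃ = 1 - p₃)
    (ha : a = p₁ * p₂ * p₃ + t * (p₁ * p₂ * q₃ + p₁ * q₂ * p₃ + q₁ * p₂ * p₃))
    (hb : b = q₁ * q₂ * q₃ + (1 - t) * (p₁ * q₂ * q₃ + q₁ * p₂ * q₃ + q₁ * q₂ * p₃))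
    (h₁₂ : m₁₂ = (1 - t) * (p₁ * p₂ * q₃)) (h₁₃ : m₁₃ = (1 - t) * (p₁ * q₂ * p₃)) (h₂₃ : m₂₃ = (1 - t) * (q₁ * p₂ * p₃))
    (h₁₄ : m₁₄ = t * (p₁ * q₂ * q₃)) (h₂₄ : m₂₄ = t * (q₁ * p₂ * q₃)) (h₃₄ : m₃₄ = t * (q₁ * q₂ * p₃))
    (hba : a ≤ b) :
    m₁₂*m₁₃*m₂₃ + m₁₂*m₁₃*m₁₄ + m₁₂*m₁₃*m₂₄ + m₁₂*m₁₃*m₃₄ + m₁₂*m₂₃*m₁₄ + m₁₂*m₂₃*m₂₄ + m₁₂*m₂₃*m₃₄ + m₁₂*m₁₄*m₂₄ +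
        m₁₂*m₁₄*m₃₄ + m₁₂*m₂₄*m₃₄ + m₁₃*m₂₃*m₁₄ + m₁₃*m₂₃*m₂₄ + m₁₃*m₂₃*m₃₄ + m₁₃*m₁₄*m₂₄ + m₁₃*m₁₄*m₃₄ + m₁₃*m₂₄*m₃₄ +
        m₂₃*m₁₄*m₂₄ + m₂₃*m₁₄*m₃₄ + m₂₃*m₂₄*m₃₄ + m₁₄*m₂₄*m₃₄ ≤
      b * (a * b - (m₁₂*m₁₃ + m₁₂*m₂₃ + m₁₂*m₁₄ + m₁₂*m₂₄ + m₁₂*m₃₄ + m₁₃*m₂₃ + m₁₃*m₁₄ + m₁₃*m₂₄ + m₁₃*m₃₄ + m₂₃*m₁₄ + m₂₃*m₂₄ +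
        m₂₃*m₃₄ + m₁₄*m₂₄ + m₁₄*m₃₄ + m₂₄*m₃₄)) := by
  have h := sixPetal_LA_nonneg (p₁ := q₁) (p₂ := q₂) (p₃ := q₃) (t := 1 - t) (q₁ := p₁) (q₂ := p₂) (q₃ := p₃)
    (a := b) (b := a) (m₁₂ := m₃₄) (m₁₃ := m₂₄) (m₂₃ := m₁₄) (m₁₄ := m₂₃) (m₂₄ := m₁₃) (m₃₄ := m₁₂)
    (by rw [hq₁]; linarith) (by rw [hq₁]; linarith) (by rw [hq₂]; linarith) (by rw [hq₂]; linarith)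
    (by rw [hq₃]; linarith) (by rw [hq₃]; linarith) (by linarith) (by linarith)
    (by rw [hq₁]; ring) (by rw [hq₂]; ring) (by rw [hq₃]; ring)
    (by rw [hb]; ring) (by rw [ha]; ring) (by rw [h₃₄]; ring) (by rw [h₂₄]; ring) (by rw [h₁₄]; ring) h₂₃ h₁₃ h₁₂ hba
  linarith [h]

/-- **(C1) ON THE SIX-PETAL GRADED `K₄` STRUCTURE** — `e₃(m) ≤ max(a,b)·(ab − e₂(m))` for all `(p₁,p₂,p₃,t) ∈ [0,1]⁴`; hence (by merging petals)
for every 3-edge-colouring of `K₄` — the last open bi-saturated classes on four points (memo §3: so (C1) holds for EVERY three-petal sunflower of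
up-sets on at most four coordinates). [this work] -/
theorem sixPetal_C1 (hp₁ : 0 ≤ p₁) (hp₁' : p₁ ≤ 1) (hp₂ : 0 ≤ p₂) (hp₂' : p₂ ≤ 1) (hp₃ : 0 ≤ p₃) (hp₃' : p₃ ≤ 1)
    (ht : 0 ≤ t) (ht' : t ≤ 1)
    (hq₁ : q₁ = 1 - p₁) (hq₂ : q₂ = 1 - p₂) (hq₃ : q₃ = 1 - p₃)
    (ha : a = p₁ * p₂ * p₃ + t * (p₁ * p₂ * q₃ + p₁ * q₂ * p₃ + q₁ * p₂ * p₃))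
    (hb : b = q₁ * q₂ * q₃ + (1 - t) * (p₁ * q₂ * q₃ + q₁ * p₂ * q₃ + q₁ * q₂ * p₃))
    (h₁₂ : m₁₂ = (1 - t) * (p₁ * p₂ * q₃)) (h₁₃ : m₁₃ = (1 - t) * (p₁ * q₂ * p₃)) (h₂₃ : m₂₃ = (1 - t) * (q₁ * p₂ * p₃))
    (h₁₄ : m₁₄ = t * (p₁ * q₂ * q₃)) (h₂₄ : m₂₄ = t * (q₁ * p₂ * q₃)) (h₃₄ : m₃₄ = t * (q₁ * q₂ * p₃)) :
    m₁₂*m₁₃*m₂₃ + m₁₂*m₁₃*m₁₄ + m₁₂*m₁₃*m₂₄ + m₁₂*m₁₃*m₃₄ + m₁₂*m₂₃*m₁₄ + m₁₂*m₂₃*m₂₄ + m₁₂*m₂₃*m₃₄ + m₁₂*m₁₄*m₂₄ +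
        m₁₂*m₁₄*m₃₄ + m₁₂*m₂₄*m₃₄ + m₁₃*m₂₃*m₁₄ + m₁₃*m₂₃*m₂₄ + m₁₃*m₂₃*m₃₄ + m₁₃*m₁₄*m₂₄ + m₁₃*m₁₄*m₃₄ + m₁₃*m₂₄*m₃₄ +
        m₂₃*m₁₄*m₂₄ + m₂₃*m₁₄*m₃₄ + m₂₃*m₂₄*m₃₄ + m₁₄*m₂₄*m₃₄ ≤
      max a b * (a * b - (m₁₂*m₁₃ + m₁₂*m₂₃ + m₁₂*m₁₄ + m₁₂*m₂₄ + m₁₂*m₃₄ + m₁₃*m₂₃ + m₁₃*m₁₄ + m₁₃*m₂₄ + m₁₃*m₃₄ + m₂₃*m₁₄ + m₂₃*m₂₄ +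
        m₂₃*m₃₄ + m₁₄*m₂₄ + m₁₄*m₃₄ + m₂₄*m₃₄)) := by
  rcases le_total b a with hab | hba
  · rw [max_eq_left hab]
    exact sixPetal_LA_nonneg hp₁ hp₁' hp₂ hp₂' hp₃ hp₃' ht ht' hq₁ hq₂ hq₃ ha hb h₁₂ h₁₃ h₂₃ h₁₄ h₂₄ h₃₄ hab
  · rw [max_eq_right hba]
    exact sixPetal_LB_nonneg hp₁ hp₁' hp₂ hp₂' hp₃ hp₃' ht ht' hq₁ hq₂ hq₃ ha hb h₁₂ h₁₃ h₂₃ h₁₄ h₂₄ h₃₄ hba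

end SixPetal

end FourPointSixPetal

end Summit.CriticalPhenomena.PercolationContinuityZ3.Theorems.SunflowerPartition
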